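import Summits.BirchSwinnertonDyer.BirchSwinnertonDyer.Theorems.PrintCFramBottomClassIndexLawFiveLeKrizLiLocusLValueFree
import HarnessLib

/-!
# Route `PrintCFram`, crux C2 `BottomClassIndexLawFiveLe` (stmt-BirchSwinnertonDyer-20372), line `eisenstein-resource-bdp-line`
# (registry v13/v14): the regular-locus theorem WITHOUT the `L`-value binder, and «KRIZ–LI DATUM ⟺ CHARACTER DATA»

Cell `bsd-print-cfram`, width seat `bsd-line-cfram-p1-w6` (generation g2); `--supports stmt-BirchSwinnertonDyer-20372` (helper).
THEOREMS ONLY (0 definitions, 0 named facts, 0 `sorry`); tree-only. Sequel of `…KrizLiLocusLValueFree`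
(`KrizLiLValueFree.entireLFunction_twist_one_ne_zero_cmRamified_of_thm120`: on the CM-ramified class the conjunct
`L(W^{(d_{K''})}, 1) ≠ 0` of a Kriz–Li datum follows from its other conjuncts by Kriz–Li Thm. 1.20 + Gross–Zagier + modularity).

HONEST FRAMING. The crux C2 is CLASS-WIDE and stays OPEN; nothing about BSD is proved here; no summit statement is proved by
this seat; no stub is closed; everything is CONDITIONAL on the displayed named facts (Kriz–Li 2019 Thm. 1.20, the seven print
facts of p630429 — Hsieh 2014 Thm. A, Liu–Zhang–Zhang 2018, `ToricPublishedInputs`, Poitou–Tate for Ш, Burungale–Flach 2024,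
modularity, Cassels).

WHAT IS PROVED.
* §1 `ramifiedCMBottomClassIndexLawAtZp_of_regularKrizLiDatum_lValueFree`: LEAD g5's regular-locus theorem
  `RegularLocus.ramifiedCMBottomClassIndexLawAtZp_of_regularKrizLiDatum` (p630429) with the binder
  `hLt : (W.quadraticTwist d_{K''}).entireLFunction 1 ≠ 0` REMOVED (supplied by the prequel).
* §2 `exists_krizLiDatum_of_characterData` / `exists_krizLiDatum_iff_exists_characterData`: for a class member `W`
  (CM, `p ≥ 5` CM-ramified, `r_an = 1`) the existential `hKLd` on which the registered composition
  `EisensteinResourceBdpLine.BottomClassIndexLawFiveLe_of` case-splits — «a Kriz–Li datum: level `N = N_W`, Heegner field `K''`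
  (`d` odd `< −4`), parametrisation `Dt`, Heegner datum `H`, embedding `ι`, Heegner point `P`, `L(W^{(d)},1) ≠ 0`, character data
  `(ψ, ω, ε_{K''})` with the trace form, (1), (3), (4)» — is EQUIVALENT, modulo `ToricPublishedInputs` (Heegner points over `K''`:
  `exists_isHeegnerPoint`, whose `IsHeegnerPoint` carries `Dt`, `H`, `ι`) and Kriz–Li Thm. 1.20, to the purely arithmetic
  «CHARACTER DATA: an imaginary quadratic `K''`, Heegner for `N_W`, `d_{K''}` odd `< −4`, and `(ψ, ω, ε_{K''})` with the trace form,
  (1), (3), (4)». Consequently the off-locus hypothesis `¬ ∃ (Kriz–Li datum)` of the two research stubs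
  (`stub_kolyvaginUpper_borelCM_pairSum_offKrizLi`, `stub_flatEisensteinIncl_cmRamified_offKrizLi`) is equivalent to
  `¬ ∃ (character data)`: OFF THE LOCUS MEANS «for every Heegner field `K''` of `N_W` with `d` odd `< −4` and every Kriz–Li
  character pair `(ψ, ω)` of `W` at `p`, `p ∣ B_{1,ψ₀⁻¹ε_{K''}}·B_{1,ψ₀ω⁻¹}`» — a statement about Bernoulli numbers and the `a_ℓ(W)`
  only (no modular parametrisation, no Heegner point, no `L`-value).
beyond-print theorem: NO (plumbing). BSD is not proved by any of this.

References: [KrizLi2019] Thm. 1.20 (pp. 7–8), Rem. 1.21 (p. 8); [GrossZagier1986] Thm. I.(6.3), I.§4; [Gross1984] §§3–4;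
[CastellaGrossiLeeSkinner2022] Thm. 5.3.1 (arXiv:2008.02571).
-/

set_option autoImplicit false
-- `…BirchSwinnertonDyer.BirchSwinnertonDyer.Theorems…` is the problem's mandated namespace (D-0017).
set_option linter.dupNamespace false

noncomputable section

open scoped Classical

namespace Summit.BirchSwinnertonDyer.BirchSwinnertonDyer.Theorems.PrintCFram.KrizLiLValueFree

open WeierstrassCurve NumberField IsDedekindDomain Field
  Literature.NumberTheory.EllipticCurves Literature.NumberTheory.EllipticCurves.GreenbergSelmer
  Literature.NumberTheory.EllipticCurves.GreenbergVatsal2000 Literature.NumberTheory.EllipticCurves.ModularForms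
  Literature.NumberTheory.EllipticCurves.Rank1Residual Literature.NumberTheory.EllipticCurves.Rank1Residual.Typed
  Literature.NumberTheory.GaloisRepresentations Literature.NumberTheory.GaloisCohomology
  Summit.BirchSwinnertonDyer.BirchSwinnertonDyer.Theses.UniversalToricDescent
  Summit.BirchSwinnertonDyer.Rank1Residual Summit.BirchSwinnertonDyer.Rank1Residual.Additive
  Summit.BirchSwinnertonDyer.Rank1Residual.X11b Summit.BirchSwinnertonDyer.Rank1Residual.X11b.AcSelmer
  Summit.BirchSwinnertonDyer.Rank1Residual.X12
  Summit.BirchSwinnertonDyer.BirchSwinnertonDyer.Theorems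
  Summit.BirchSwinnertonDyer.BirchSwinnertonDyer.Theorems.PrintCFram

/-! ## §1 The regular-locus theorem (p630429) without the `L`-value binder -/

section RegularLocus

variable {p : ℕ} [Fact p.Prime]

/-- **The crux's CONCLUSION for `W` on the REGULAR KRIZ–LI LOCUS, modulo PRINT only, WITHOUT the binder `L(W^{(d_{K''})}, 1) ≠ 0`.**
Verbatim `RegularLocus.ramifiedCMBottomClassIndexLawAtZp_of_regularKrizLiDatum` (p630429: `W/ℚ` globally minimal CM, `p ≥ 5`
CM-ramified, `r_an(W) = 1`; a Heegner field `K''` of `N_W` with `d` odd `< −4`, a Heegner point `P`; Kriz–Li's `(ψ, ω)` with the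
trace form, (1), (3); `ε_{K''}` and (4); one anticyclotomic frame `(κ, γ, 𝔭 ∋ p)` that is REGULAR in the residual-Selmer currency
`hreg`) except that its hypothesis `hLt` is now DERIVED (`entireLFunction_twist_one_ne_zero_cmRamified_of_thm120`: Kriz–Li ⟹ `P`
non-torsion ⟹ Gross–Zagier ⟹ `r_an(W) + r_an(W^{(d)}) ≤ 1` ⟹ `L(W^{(d)}, 1) ≠ 0`). CONDITIONAL on the seven print facts
`hprints` and Kriz–Li Thm. 1.20 `hKL`; closes nothing; BSD is not proved by any of this.
[cite: KrizLi2019, Thm. 1.20 (pp. 7–8), Rem. 1.21 (p. 8)] [cite: CastellaGrossiLeeSkinner2022, Thm. 5.3.1 (arXiv:2008.02571)]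
[cite: GrossZagier1986, Thm. I.(6.3) and V.§2] -/
theorem ramifiedCMBottomClassIndexLawAtZp_of_regularKrizLiDatum_lValueFree
    (hprints : Hsieh2014.thmA_exists_isHsiehLFunction_unrPeriod_anyLevel ∧
      LiuZhangZhang2018.thm151_thm153_modularCurve_heegnerVector_additive ∧
      ToricPublishedInputs ∧
      (∀ (K : Type) [Field K] [NumberField K], poitouTate_sha_tateDual K) ∧
      bsdTriple_of_hasCM_of_L_one_ne_zero ∧ hasEntireLFunction_rat ∧ bsdRHS_eq_of_isIsogenous)
    (hKL : KrizLi2019.thm120_padicLogHeegner_unit_of_bernoulli)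
    (W : WeierstrassCurve ℚ) [W.IsElliptic] [W.IsGloballyMinimal] (hCM : W.HasCM) (hram : CMRamified W p) (h5 : 5 ≤ p)
    (hr : W.analyticRank = 1)
    (N : ℕ) [NeZero N] (K : Type) [Field K] [NumberField K]
    (Dt : ModularParametrizationData W N) (H : HeegnerDatum N (NumberField.discr K)) (ι : K →+* ℂ)
    (P : (W.baseChange K).toAffine.Point)
    (hN : W.conductorNorm ℤ = N) (hK : IsImaginaryQuadratic K) (hHN : SatisfiesHeegnerHypothesis N K)
    (hodd : Odd (NumberField.discr K)) (hd4 : NumberField.discr K < -4)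
    (hP : WeierstrassCurve.Affine.Point.map ι.toRatAlgHom P = heegnerPointComplex Dt H)
    (f : ℕ) [NeZero f] (ψ : DirichletCharacter ℚ_[p] f) (ω : DirichletCharacter ℚ_[p] p)
    (hψ : ψ.IsPrimitive) (hω : KrizLi2019.IsTeichmullerCharacter ω)
    (hss : ∀ ℓ : ℕ, ℓ.Prime → ¬ (ℓ ∣ p * W.conductorNorm ℤ) →
      ‖((W.LFunction ℓ : ℤ) : ℚ_[p]) - (ψ (ℓ : ZMod f) + ψ⁻¹ (ℓ : ZMod f) * ω (ℓ : ZMod p))‖ < 1)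
    (h1 : ψ (p : ZMod f) ≠ 1) (h1' : KrizLi2019.primVal (KrizLi2019.invMulOmega ψ ω) p ≠ 1)
    (h3 : ∀ ℓ : ℕ, (hℓ : ℓ.Prime) → ℓ ≠ p →
      (haveI := Fact.mk hℓ; ¬ W.HasGoodReductionAtPrime ℓ ∧ ¬ W.HasMultiplicativeReductionAtPrime ℓ) →
      ψ (ℓ : ZMod f) ≠ 1 ∧ KrizLi2019.primVal (KrizLi2019.invMulOmega ψ ω) ℓ ≠ 1)
    (εK : DirichletCharacter ℚ_[p] (NumberField.discr K).natAbs) (hεK : KrizLi2019.IsKroneckerCharacterOf K εK)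
    (h4 : ¬ (‖KrizLi2019.bernoulliOnePrim (KrizLi2019.bernoulliCharOne ψ εK) *
        KrizLi2019.bernoulliOnePrim (KrizLi2019.bernoulliCharTwo ψ εK ω)‖ ≤ (p : ℝ)⁻¹))
    (κ : ZpExtension K p) (hκ : κ.IsAnticyclotomic) (γ : Field.absoluteGaloisGroup K) [Fact (κ.IsTopGenerator γ)]
    (𝔭 : HeightOneSpectrum (𝓞 K)) (h𝔭 : ((p : ℕ) : 𝓞 K) ∈ 𝔭.asIdeal)
    (hreg : ∃ Φ : X2.ResidualDevissageModules.StableSubgroup (absoluteGaloisGroup K) ((W.baseChange K).geomTorsion (p : ℤ)),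
      (∀ y : Φ.Quot, (∀ g : ↥(κ.kerSubgroup ⊓ GreenbergSelmer.decomp 𝔭), g • y = y) → y = 0) ∧
      Nat.card (datumStrictSelmer κ.kerSubgroup Φ.Sub p (AcSelmer.bdpData Φ.Sub p 𝔭)
          {v : HeightOneSpectrum (𝓞 K) | ¬ (W.baseChange K).HasGoodReductionAt v ∧ ((p : ℕ) : 𝓞 K) ∉ v.asIdeal}) = 1 ∧
      Nat.card (datumStrictSelmer κ.kerSubgroup Φ.Quot p (AcSelmer.bdpData Φ.Quot p 𝔭)
          {v : HeightOneSpectrum (𝓞 K) | ¬ (W.baseChange K).HasGoodReductionAt v ∧ ((p : ℕ) : 𝓞 K) ∉ v.asIdeal}) = 1) :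
    X12.O11.RamifiedCMBottomClassIndexLawAtZp W p :=
  RegularLocus.ramifiedCMBottomClassIndexLawAtZp_of_regularKrizLiDatum hprints hKL W hCM hram h5 hr N K Dt H ι P hN hK hHN hodd
    hd4
    (entireLFunction_twist_one_ne_zero_cmRamified_of_thm120 hKL hprints.2.2.1 W hCM hram h5 hr N K Dt H ι P hN hK hHN hP f ψ ω
      hψ hω hss h1 h1' h3 εK hεK h4)
    hP f ψ ω hψ hω hss h1 h1' h3 εK hεK h4 κ hκ γ 𝔭 h𝔭 hreg

end RegularLocus

/-! ## §2 «Kriz–Li datum ⟺ character data» on the class, modulo `ToricPublishedInputs` and Kriz–Li Thm. 1.20 -/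

section CharacterData

variable {p : ℕ} [Fact p.Prime]

/-- **CHARACTER DATA ⟹ a KRIZ–LI DATUM.** For `W/ℚ` globally minimal with CM, `p ≥ 5` CM-ramified, `r_an(W) = 1`: from an
imaginary quadratic `K''`, Heegner for `N_W`, with `d_{K''}` odd `< −4`, and Kriz–Li character data `(ψ, ω, ε_{K''})` at
`(W, p, K'')` — `ψ` primitive, `ω` Teichmüller, the trace form `a_ℓ(W) ≡ ψ(ℓ) + ψ⁻¹ω(ℓ)`, (1), (3), the Kronecker character, and
(4) `B_{1,ψ₀⁻¹ε_K}·B_{1,ψ₀ω⁻¹} ≢ 0 (mod p)` — one gets the full existential `hKLd` of the registered composition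
`EisensteinResourceBdpLine.BottomClassIndexLawFiveLe_of` (level `N_W`, `K''`, `Dt`, `H`, `ι`, `P`, `L(W^{(d)},1) ≠ 0`, the same
character data): the Heegner point with its parametrisation / Heegner datum / embedding is the conjunct `exists_isHeegnerPoint` of
`ToricPublishedInputs` (`IsHeegnerPoint` unfolds to `∃ Dt H ι, P ↦ heegnerPointComplex Dt H`), and the `L`-value is
`entireLFunction_twist_one_ne_zero_cmRamified_of_thm120`. CONDITIONAL on `hKL`, `hF`; closes nothing.
[cite: KrizLi2019, Thm. 1.20 (pp. 7–8), Rem. 1.21 (p. 8)] [cite: GrossZagier1986, I.§4 and Thm. I.(6.3)] [cite: Gross1984, §§3–4] -/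
theorem exists_krizLiDatum_of_characterData
    (hKL : KrizLi2019.thm120_padicLogHeegner_unit_of_bernoulli) (hF : ToricPublishedInputs)
    (W : WeierstrassCurve ℚ) [W.IsElliptic] [W.IsGloballyMinimal] (hCM : W.HasCM) (hram : CMRamified W p) (h5 : 5 ≤ p)
    (hr : W.analyticRank = 1)
    (K : Type) [Field K] [NumberField K] (hK : IsImaginaryQuadratic K)
    (hHN : SatisfiesHeegnerHypothesis (W.conductorNorm ℤ) K) (hodd : Odd (NumberField.discr K)) (hd4 : NumberField.discr K < -4)
    (f : ℕ) [NeZero f] (ψ : DirichletCharacter ℚ_[p] f) (ω : DirichletCharacter ℚ_[p] p)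
    (hψ : ψ.IsPrimitive) (hω : KrizLi2019.IsTeichmullerCharacter ω)
    (hss : ∀ ℓ : ℕ, ℓ.Prime → ¬ (ℓ ∣ p * W.conductorNorm ℤ) →
      ‖((W.LFunction ℓ : ℤ) : ℚ_[p]) - (ψ (ℓ : ZMod f) + ψ⁻¹ (ℓ : ZMod f) * ω (ℓ : ZMod p))‖ < 1)
    (h1 : ψ (p : ZMod f) ≠ 1) (h1' : KrizLi2019.primVal (KrizLi2019.invMulOmega ψ ω) p ≠ 1)
    (h3 : ∀ ℓ : ℕ, (hℓ : ℓ.Prime) → ℓ ≠ p →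
      (haveI := Fact.mk hℓ; ¬ W.HasGoodReductionAtPrime ℓ ∧ ¬ W.HasMultiplicativeReductionAtPrime ℓ) →
      ψ (ℓ : ZMod f) ≠ 1 ∧ KrizLi2019.primVal (KrizLi2019.invMulOmega ψ ω) ℓ ≠ 1)
    (εK : DirichletCharacter ℚ_[p] (NumberField.discr K).natAbs) (hεK : KrizLi2019.IsKroneckerCharacterOf K εK)
    (h4 : ¬ (‖KrizLi2019.bernoulliOnePrim (KrizLi2019.bernoulliCharOne ψ εK) *
        KrizLi2019.bernoulliOnePrim (KrizLi2019.bernoulliCharTwo ψ εK ω)‖ ≤ (p : ℝ)⁻¹)) :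
    ∃ (N : ℕ) (_ : NeZero N) (K : Type) (_ : Field K) (_ : NumberField K) (Dt : ModularParametrizationData W N)
      (H : HeegnerDatum N (NumberField.discr K)) (ι : K →+* ℂ) (P : (W.baseChange K).toAffine.Point)
      (f : ℕ) (_ : NeZero f) (ψ : DirichletCharacter ℚ_[p] f) (ω : DirichletCharacter ℚ_[p] p)
      (εK : DirichletCharacter ℚ_[p] (NumberField.discr K).natAbs),
      W.conductorNorm ℤ = N ∧ IsImaginaryQuadratic K ∧ SatisfiesHeegnerHypothesis N K ∧ Odd (NumberField.discr K) ∧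
      NumberField.discr K < -4 ∧ (W.quadraticTwist (NumberField.discr K : ℚ)).entireLFunction 1 ≠ 0 ∧
      WeierstrassCurve.Affine.Point.map ι.toRatAlgHom P = heegnerPointComplex Dt H ∧
      ψ.IsPrimitive ∧ KrizLi2019.IsTeichmullerCharacter ω ∧
      (∀ ℓ : ℕ, ℓ.Prime → ¬ (ℓ ∣ p * W.conductorNorm ℤ) →
        ‖((W.LFunction ℓ : ℤ) : ℚ_[p]) - (ψ (ℓ : ZMod f) + ψ⁻¹ (ℓ : ZMod f) * ω (ℓ : ZMod p))‖ < 1) ∧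
      ψ (p : ZMod f) ≠ 1 ∧ KrizLi2019.primVal (KrizLi2019.invMulOmega ψ ω) p ≠ 1 ∧
      (∀ ℓ : ℕ, (hℓ : ℓ.Prime) → ℓ ≠ p →
        (haveI := Fact.mk hℓ; ¬ W.HasGoodReductionAtPrime ℓ ∧ ¬ W.HasMultiplicativeReductionAtPrime ℓ) →
        ψ (ℓ : ZMod f) ≠ 1 ∧ KrizLi2019.primVal (KrizLi2019.invMulOmega ψ ω) ℓ ≠ 1) ∧
      KrizLi2019.IsKroneckerCharacterOf K εK ∧
      ¬ (‖KrizLi2019.bernoulliOnePrim (KrizLi2019.bernoulliCharOne ψ εK) *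
          KrizLi2019.bernoulliOnePrim (KrizLi2019.bernoulliCharTwo ψ εK ω)‖ ≤ (p : ℝ)⁻¹) := by
  haveI hN0 : NeZero (W.conductorNorm ℤ) := ⟨W.conductorNorm_pos_holds.ne'⟩
  obtain ⟨-, -, -, -, -, -, -, -, -, hHP⟩ := id hF
  obtain ⟨P, Dt, H, ι, hP⟩ := hHP W K hK hHN
  have hLt : (W.quadraticTwist (NumberField.discr K : ℚ)).entireLFunction 1 ≠ 0 :=
    entireLFunction_twist_one_ne_zero_cmRamified_of_thm120 hKL hF W hCM hram h5 hr (W.conductorNorm ℤ) K Dt H ι P rfl hK hHN hP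
      f ψ ω hψ hω hss h1 h1' h3 εK hεK h4
  refine ⟨W.conductorNorm ℤ, hN0, K, inferInstance, inferInstance, Dt, H, ι, P, f, inferInstance, ψ, ω, εK, rfl, hK, hHN, hodd,
    hd4, hLt, hP, hψ, hω, hss, h1, h1', ?_, hεK, h4⟩
  exact h3

/-- **KRIZ–LI DATUM ⟺ CHARACTER DATA** (modulo `ToricPublishedInputs` and Kriz–Li Thm. 1.20). For a class member `W`
(CM, `p ≥ 5` CM-ramified, `r_an = 1`), the existential on which the registered composition of crux 20372 case-splits is
equivalent to the existence of CHARACTER DATA at some Heegner field of `N_W` with `d` odd `< −4`. `→`: forget `Dt`, `H`, `ι`,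
`P` and the `L`-value; `←`: `exists_krizLiDatum_of_characterData`. So the NEGATION carried by the off-locus research stubs reads:
for every such `K''` and every Kriz–Li character triple at `(W, p, K'')`, hypothesis (4) FAILS (`p ∣ B_{1,ψ₀⁻¹ε_K}·B_{1,ψ₀ω⁻¹}`).
CONDITIONAL on `hKL`, `hF`; closes nothing; BSD is not proved by any of this.
[cite: KrizLi2019, Thm. 1.20 (pp. 7–8), Rem. 1.21 (p. 8) and p. 3] [cite: GrossZagier1986, I.§4 and Thm. I.(6.3)] -/
theorem exists_krizLiDatum_iff_exists_characterData
    (hKL : KrizLi2019.thm120_padicLogHeegner_unit_of_bernoulli) (hF : ToricPublishedInputs)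
    (W : WeierstrassCurve ℚ) [W.IsElliptic] [W.IsGloballyMinimal] (hCM : W.HasCM) (hram : CMRamified W p) (h5 : 5 ≤ p)
    (hr : W.analyticRank = 1) :
    (∃ (N : ℕ) (_ : NeZero N) (K : Type) (_ : Field K) (_ : NumberField K) (Dt : ModularParametrizationData W N)
      (H : HeegnerDatum N (NumberField.discr K)) (ι : K →+* ℂ) (P : (W.baseChange K).toAffine.Point)
      (f : ℕ) (_ : NeZero f) (ψ : DirichletCharacter ℚ_[p] f) (ω : DirichletCharacter ℚ_[p] p)
      (εK : DirichletCharacter ℚ_[p] (NumberField.discr K).natAbs),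
      W.conductorNorm ℤ = N ∧ IsImaginaryQuadratic K ∧ SatisfiesHeegnerHypothesis N K ∧ Odd (NumberField.discr K) ∧
      NumberField.discr K < -4 ∧ (W.quadraticTwist (NumberField.discr K : ℚ)).entireLFunction 1 ≠ 0 ∧
      WeierstrassCurve.Affine.Point.map ι.toRatAlgHom P = heegnerPointComplex Dt H ∧
      ψ.IsPrimitive ∧ KrizLi2019.IsTeichmullerCharacter ω ∧
      (∀ ℓ : ℕ, ℓ.Prime → ¬ (ℓ ∣ p * W.conductorNorm ℤ) →
        ‖((W.LFunction ℓ : ℤ) : ℚ_[p]) - (ψ (ℓ : ZMod f) + ψ⁻¹ (ℓ : ZMod f) * ω (ℓ : ZMod p))‖ < 1) ∧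
      ψ (p : ZMod f) ≠ 1 ∧ KrizLi2019.primVal (KrizLi2019.invMulOmega ψ ω) p ≠ 1 ∧
      (∀ ℓ : ℕ, (hℓ : ℓ.Prime) → ℓ ≠ p →
        (haveI := Fact.mk hℓ; ¬ W.HasGoodReductionAtPrime ℓ ∧ ¬ W.HasMultiplicativeReductionAtPrime ℓ) →
        ψ (ℓ : ZMod f) ≠ 1 ∧ KrizLi2019.primVal (KrizLi2019.invMulOmega ψ ω) ℓ ≠ 1) ∧
      KrizLi2019.IsKroneckerCharacterOf K εK ∧
      ¬ (‖KrizLi2019.bernoulliOnePrim (KrizLi2019.bernoulliCharOne ψ εK) *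
          KrizLi2019.bernoulliOnePrim (KrizLi2019.bernoulliCharTwo ψ εK ω)‖ ≤ (p : ℝ)⁻¹)) ↔
    ∃ (K : Type) (_ : Field K) (_ : NumberField K)
      (f : ℕ) (_ : NeZero f) (ψ : DirichletCharacter ℚ_[p] f) (ω : DirichletCharacter ℚ_[p] p)
      (εK : DirichletCharacter ℚ_[p] (NumberField.discr K).natAbs),
      IsImaginaryQuadratic K ∧ SatisfiesHeegnerHypothesis (W.conductorNorm ℤ) K ∧ Odd (NumberField.discr K) ∧
      NumberField.discr K < -4 ∧ ψ.IsPrimitive ∧ KrizLi2019.IsTeichmullerCharacter ω ∧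
      (∀ ℓ : ℕ, ℓ.Prime → ¬ (ℓ ∣ p * W.conductorNorm ℤ) →
        ‖((W.LFunction ℓ : ℤ) : ℚ_[p]) - (ψ (ℓ : ZMod f) + ψ⁻¹ (ℓ : ZMod f) * ω (ℓ : ZMod p))‖ < 1) ∧
      ψ (p : ZMod f) ≠ 1 ∧ KrizLi2019.primVal (KrizLi2019.invMulOmega ψ ω) p ≠ 1 ∧
      (∀ ℓ : ℕ, (hℓ : ℓ.Prime) → ℓ ≠ p →
        (haveI := Fact.mk hℓ; ¬ W.HasGoodReductionAtPrime ℓ ∧ ¬ W.HasMultiplicativeReductionAtPrime ℓ) →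
        ψ (ℓ : ZMod f) ≠ 1 ∧ KrizLi2019.primVal (KrizLi2019.invMulOmega ψ ω) ℓ ≠ 1) ∧
      KrizLi2019.IsKroneckerCharacterOf K εK ∧
      ¬ (‖KrizLi2019.bernoulliOnePrim (KrizLi2019.bernoulliCharOne ψ εK) *
          KrizLi2019.bernoulliOnePrim (KrizLi2019.bernoulliCharTwo ψ εK ω)‖ ≤ (p : ℝ)⁻¹) := by
  constructor
  · rintro ⟨N, iN, K, iF, iNF, -, -, -, -, f, iF', ψ, ω, εK, hN, hK, hHN, hodd, hd4, -, -, hψ, hω, hss, h1, h1', h3, hεK, h4⟩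
    subst hN
    refine ⟨K, iF, iNF, f, iF', ψ, ω, εK, hK, hHN, hodd, hd4, hψ, hω, hss, h1, h1', ?_, hεK, h4⟩
    exact h3
  · rintro ⟨K, iF, iNF, f, iF', ψ, ω, εK, hK, hHN, hodd, hd4, hψ, hω, hss, h1, h1', h3, hεK, h4⟩
    exact exists_krizLiDatum_of_characterData hKL hF W hCM hram h5 hr K hK hHN hodd hd4 f ψ ω hψ hω hss h1 h1' h3 εK hεK h4

end CharacterData

end Summit.BirchSwinnertonDyer.BirchSwinnertonDyer.Theorems.PrintCFram.KrizLiLValueFree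

end
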